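/-
Origin: expansion seat `planner-pub-hodgecm-mc-axioms-1-g14-0`, handover #W165 2026-08-20T15:53:55Z md5 70c86f9d95cc (PKG 84c3daae6b1c → 70c86f9d95cc; 70 l.; MECHANICAL (iib-R) rewrite v3.1 of the PKG file as it stands (10 token edits; rules R1x1+RX[h₂']x9)) (`HOME/mc/pub-hodgecm-mc-axioms-1-g14/revendor/kit-r55/stage55/HodgeCM/Model/EmbBettiDischarge.lean`, md5 70c86f9d95cc, 70 lines);
landed by the gen-22 packager (p-g22) in gate run 55 REPLACES the earlier landed copy of `HodgeCM/Model/EmbBettiDischarge.lean` (seat copy carried the packager Origin header of an earlier run (stripped)).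
-/
/-
Origin: CONSTRUCTION seat `planner-pub-hodgecm-mc-period-1-g4-0` (unit pub-hodgecm-mc-period-1-g4, gen 4 of
mc-period-1, period lane), 2026-08-19.  NEW additive KERNEL leaf `HodgeCM/Model/EmbBettiDischarge.lean`.
Imports: glue-1-g3's `HodgeCM.Model.InnerEmbReduction` (`Model.EmbBettiSide`, RUN 33 #285) and the vendored twin
of the tree leaf (T1) `Literature/AlgebraicGeometry/HodgeTheory/StandardModelTraceIntegral.lean` (this seat).
No proof holes, no new hypotheses minted: the only inputs are the universe's two standing Literature rows
`hHD : exists_isReal_hodgeModel`, `hI : hodgePQ_independent_of_hodgeModel` and the three PicardCM records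
`h₁ h₃` already carried by `EmbBettiSide` itself.
Expected `#print axioms`: {propext, Classical.choice, Quot.sound}.
-/
import Summits.HodgeConjecture.HodgeCM.Model.InnerEmbReduction
import Literature.AlgebraicGeometry.HodgeTheory.StandardModelTraceIntegral

/-!
# The Betti half of C2 for `emb := Model.embOf` — DISCHARGED (E binder `hBetti`)

`Model.EmbBettiSide hHD hI h₁ h₃ V` (`Model/InnerEmbReduction.lean`) asks, for every level `Γ` of the
hermitian space `V`: a constant orientation `o₀` of `ℂ² ≅ ℝ⁴`, continuous as an orientation of the STANDARD
analytification `X_Γ^an` (`embHodgeModel Γ := stdModel hHD (isSmoothProjective_pms …)`), and ONE `c ≠ 0` with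
`trC (η ∪ conj η′) = c · ∫_{o₀} ω_η ∧ conj ω_{η′}` for all `η, η′ ∈ F²H²(X_Γ, ℂ)`, `ω_η := embTopForm Γ η`.

This is, read through the `rfl`-junction `picardCMUniverse = universeOf …` (`U.Coh = bettiCohomology`,
`U.hodge = BettiUniverse.hodge hHD _`, `U.cup = BettiUniverse.cup`, `U.tr = BettiUniverse.tr`, hence
`U.trC X 4 = BettiUniverse.trC _ 4` and `U.cup2C X 2 = (BettiUniverse.cup _ 2 2) ⊗ ℂ` by unfolding), LITERALLY the
tree theorem (T1)
`Literature.AlgebraicGeometry.HodgeTheory.stdModel_exists_trC_cup_conj_eq_mul_cintegral_topFormOfClass_surface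
hHD hI (hX : IsSmoothProjective 2 X)` at `hX := isSmoothProjective_pms h₁ h₃ Γ`:
the Betti-side trace/integral identity of `BettiUniverseTraceIntegralHolomorphic` (Voisin I §6.3.2 + Cor. 7.6,
Warner 5.45) on the standard Hodge model, whose two geometric inputs — a continuous orientation and a closed top
form with non-zero integral ON THE STANDARD CARRIER — (T1) obtains by transport along the GAGA biholomorphism
`X^an_std ≅ X^an_B` to the carrier of a Kähler–rational datum (Kähler volume form, Voisin I §3.1.3 Lemma 3.8;
holomorphic diffeomorphisms preserve the complex orientations, Huybrechts Cor. 1.2.3; `∫ Φ^*β = ∫ β`,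
Warner 4.8 (5)).

**Result** `Model.embBettiSideOf hHD hI h₁ h₃ V : EmbBettiSide hHD hI h₁ h₃ V` — for EVERY hermitian space
`V` (no anisotropy needed on the Betti side).  E-drop recipe for the assembler (`E2InstanceR13` →): the binder
`hBetti : ∀ {L ι₁} (V : HermSpace3 L ι₁), Model.EmbBettiSide hHD hI h₁ h₂ h₃ V` of `Model.perL_picardCM_r13` is
`fun V ↦ Model.embBettiSideOf hHD hI h₁ h₂ h₃ V`.
-/

noncomputable section

open Literature.AlgebraicGeometry.Motives
open Literature.AlgebraicGeometry.HodgeTheory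
open Literature.NumberTheory.Automorphic.PicardCM

namespace HodgeCM

namespace Model

variable (hHD : exists_isReal_hodgeModel) (hI : hodgePQ_independent_of_hodgeModel)
  (h₁ : BallQuotientUniformised)  (h₃ : CMAbelianVarietyRealised)

variable {L : CMField} {ι₁ : L →+* ℂ}

/-- **The Betti half of C2 holds for `embOf`, at every hermitian space `V` and every level `Γ`** — KERNEL over
`hHD`, `hI` (tree (T1) `stdModel_exists_trC_cup_conj_eq_mul_cintegral_topFormOfClass_surface` at
`hX := isSmoothProjective_pms h₁ h₃ Γ`, by unfolding the `rfl`-junction of `picardCMUniverse`). -/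
theorem embBettiSideOf (V : HermSpace3 L ι₁) : EmbBettiSide hHD hI h₁ h₃ V := fun Γ ↦
  stdModel_exists_trC_cup_conj_eq_mul_cintegral_topFormOfClass_surface hHD hI (isSmoothProjective_pms h₁ h₃ Γ)

end Model

end HodgeCM

end
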